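import Mathlib
import Literature.Analysis.FluidPDE.ConstantinDirectionDissipationProofs
import Summits.NavierStokesRegularity.NavierStokesRegularity.Theses.DirectionEnergy
import HarnessLib

/-!
# `DirectionEnergy.ConstantinBudget` — Constantin's a-priori direction-energy budget
  (item stmt-NavierStokesRegularity-2895)

**Statement (as typed).** For a classical solution `(u, p)` of unforced Navier–Stokes on
`ℝ³ × [0, T)`, Leray–Hopf from a rapidly decaying datum, and `T' ∈ (0, T)`:
`∫∫_{(0,T') × ℝ³} |ω| |∇ξ|²_F ≤ ν⁻¹ · ∫⁻ x, (‖ω₀ x‖ₑ + ν⁻² · ∫⁻ ‖u₀‖ₑ²)` (lower Lebesgue integrals,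
`ω = curl u`, `ξ = vorticityDirection ω`).

PROOF. The tree's discharged named fact `constantin1990_direction_dissipation_bound_holds`
(Constantin 1990, CMP 129, §2) gives `ν ∫∫_{(0,T) × ℝ³} |ω| |∇ξ|²_F ≤ ‖ω₀‖_{L¹} + (2ν)⁻¹ ‖u₀‖²_{L²}`;
restricting the time window to `(0, T')` and dividing by `ν` gives the INTENDED budget
`ν⁻¹ ‖ω₀‖₁ + ν⁻² ‖u₀‖₂² / 2`, which is then weakened to the typed right-hand side. NOTE ON THE
TYPED STATEMENT (grounder g19-21, 2026-08-15, confirmed here in the kernel): the `∫⁻ x, …` binder of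
the first summand absorbs the second summand, so the typed right-hand side is `ν⁻¹ ∫⁻ x, (‖ω₀ x‖ₑ +
ν⁻² ‖u₀‖₂²)`, which is `∞` unless `‖u₀‖₂ = 0` (a positive constant integrated over `ℝ³`), and
`ν⁻¹ ‖ω₀‖₁` when `‖u₀‖₂ = 0`; in both cases it dominates the intended budget, so the item is TRUE as
typed and is closed by the intended estimate (theorem `directionEnergy_budget_intended` below,
the honest content). The planner may re-sign the item with parentheses; the intended form is
already proved here.

HONEST FRAMING: a known a-priori estimate (Constantin 1990) transcribed from an accepted tree
theorem; nothing here bears on the regularity problem itself.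
-/

noncomputable section

set_option linter.dupNamespace false

namespace Summit.NavierStokesRegularity.NavierStokesRegularity.Theorems

open MeasureTheory Set Filter Topology Literature.Analysis.FluidPDE

/-- **Constantin's budget, intended form** (Constantin 1990, §2, (2.6)–(2.7), (2.21)): for a
classical Leray–Hopf solution from a rapidly decaying datum and `T' ≤ T`,
`∫∫_{(0,T') × ℝ³} ‖ω‖ₑ · |∇ξ|²_F ≤ ν⁻¹ ‖ω₀‖_{L¹} + ν⁻² ‖u₀‖²_{L²} / 2` — in the integrand convention of
the route decl (`‖ω‖ₑ * ENNReal.ofReal |∇ξ|²_F`). [cite: Constantin1990, §2 eqs. (2.6)–(2.7) and (2.21)] -/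
theorem directionEnergy_budget_intended {ν T : ℝ} (hν : 0 < ν) (hT : 0 < T)
    {u : ℝ → EuclideanSpace ℝ (Fin 3) → EuclideanSpace ℝ (Fin 3)}
    {p : ℝ → EuclideanSpace ℝ (Fin 3) → ℝ}
    (hsol : IsClassicalNSSolutionOn (Ico 0 T) ν 0 u p) (hLH : IsLerayHopfOn T ν 0 (u 0) u)
    (h₀ : HasRapidSpatialDecay (u 0)) {T' : ℝ} (hT' : T' ≤ T) :
    (∫⁻ q in Ioo 0 T' ×ˢ (univ : Set (EuclideanSpace ℝ (Fin 3))),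
        ‖curl (u q.1) q.2‖ₑ *
          ENNReal.ofReal (frobeniusNormSq (fderiv ℝ (vorticityDirection (curl (u q.1))) q.2))) ≤
      ENNReal.ofReal ν⁻¹ * (∫⁻ x, ‖curl (u 0) x‖ₑ) +
        ENNReal.ofReal (ν⁻¹ ^ 2 / 2) * ∫⁻ x, ‖u 0 x‖ₑ ^ 2 := by
  have h := constantin1990_direction_dissipation_bound_holds ν T hν hT u p hsol hLH h₀
  have hν0 : ENNReal.ofReal ν ≠ 0 := (ENNReal.ofReal_pos.2 hν).ne'
  -- the integrand of the route decl is the integrand of the named fact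
  have hint : ∀ q : ℝ × EuclideanSpace ℝ (Fin 3),
      ‖curl (u q.1) q.2‖ₑ *
          ENNReal.ofReal (frobeniusNormSq (fderiv ℝ (vorticityDirection (curl (u q.1))) q.2)) =
        ENNReal.ofReal (‖curl (u q.1) q.2‖ *
          frobeniusNormSq (fderiv ℝ (vorticityDirection (curl (u q.1))) q.2)) := by
    intro q
    rw [ENNReal.ofReal_mul (norm_nonneg _), ofReal_norm]
  -- shrink the time window and divide by `ν`
  calc (∫⁻ q in Ioo 0 T' ×ˢ (univ : Set (EuclideanSpace ℝ (Fin 3))),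
        ‖curl (u q.1) q.2‖ₑ *
          ENNReal.ofReal (frobeniusNormSq (fderiv ℝ (vorticityDirection (curl (u q.1))) q.2)))
      ≤ ∫⁻ q in Ioo 0 T ×ˢ (univ : Set (EuclideanSpace ℝ (Fin 3))),
          ENNReal.ofReal (‖curl (u q.1) q.2‖ *
            frobeniusNormSq (fderiv ℝ (vorticityDirection (curl (u q.1))) q.2)) := by
        simp_rw [hint]
        exact lintegral_mono_set (prod_mono (Ioo_subset_Ioo_right hT') le_rfl)
    _ ≤ ((∫⁻ x, ‖curl (u 0) x‖ₑ) + (ENNReal.ofReal (2 * ν))⁻¹ * ∫⁻ x, ‖u 0 x‖ₑ ^ 2) /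
          ENNReal.ofReal ν := by
        rw [ENNReal.le_div_iff_mul_le (Or.inl hν0) (Or.inl ENNReal.ofReal_ne_top), mul_comm]
        exact h
    _ = ENNReal.ofReal ν⁻¹ * (∫⁻ x, ‖curl (u 0) x‖ₑ) +
          ENNReal.ofReal (ν⁻¹ ^ 2 / 2) * ∫⁻ x, ‖u 0 x‖ₑ ^ 2 := by
        rw [ENNReal.div_eq_inv_mul, ← ENNReal.ofReal_inv_of_pos hν, mul_add, ← mul_assoc,
          ← ENNReal.ofReal_inv_of_pos (by positivity : (0 : ℝ) < 2 * ν),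
          ← ENNReal.ofReal_mul (inv_nonneg.2 hν.le)]
        congr 3
        field_simp

/-- **Item stmt-NavierStokesRegularity-2895** (`DirectionEnergy.ConstantinBudget`), closed AS
TYPED: the intended budget `directionEnergy_budget_intended` is weakened to the typed right-hand
side `ν⁻¹ ∫⁻ x, (‖ω₀ x‖ₑ + ν⁻² ‖u₀‖₂²)` (the `∫⁻` binder absorbs the second summand; it equals `∞`
unless `‖u₀‖₂ = 0`, and `ν⁻¹‖ω₀‖₁` otherwise). [cite: Constantin1990, §2 eqs. (2.6)–(2.7) and (2.21)] -/
theorem directionEnergy_constantinBudget_proof :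
    Summit.NavierStokesRegularity.NavierStokesRegularity.Theses.DirectionEnergy.ConstantinBudget := by
  unfold Summit.NavierStokesRegularity.NavierStokesRegularity.Theses.DirectionEnergy.ConstantinBudget
  intro ν T hν hT u p hsol hLH h₀ T' hT'
  refine (directionEnergy_budget_intended hν hT hsol hLH h₀ hT'.2.le).trans ?_
  set E : ENNReal := ∫⁻ x, ‖u 0 x‖ₑ ^ 2 with hE
  by_cases hE0 : E = 0
  · rw [hE0, mul_zero, mul_zero, add_zero]
    simp
  · -- the typed right-hand side is `⊤`
    have hc : ENNReal.ofReal (ν⁻¹ ^ 2) * E ≠ 0 :=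
      mul_ne_zero (ENNReal.ofReal_pos.2 (by positivity)).ne' hE0
    have htop : (∫⁻ x : EuclideanSpace ℝ (Fin 3), (‖curl (u 0) x‖ₑ + ENNReal.ofReal (ν⁻¹ ^ 2) * E))
        = ⊤ := by
      refine top_le_iff.1 ?_
      calc (⊤ : ENNReal) = ∫⁻ _ : EuclideanSpace ℝ (Fin 3), ENNReal.ofReal (ν⁻¹ ^ 2) * E := by
            rw [lintegral_const, measure_univ_of_isAddLeftInvariant volume, ENNReal.mul_top hc]
        _ ≤ _ := lintegral_mono fun x => le_add_self
    rw [htop, ENNReal.mul_top (ENNReal.ofReal_pos.2 (inv_pos.2 hν)).ne']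
    exact le_top

end Summit.NavierStokesRegularity.NavierStokesRegularity.Theorems

end
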